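import Literature.Computability.MetaComplexity.EFModAddUAssocKit
import HarnessLib

/-!
# Plain (non-modular) ripple-carry arithmetic in extended Frege: associativity and adding zero

Layer P/1. Laws of the plain `W`-bit ripple-carry adder (`Adder.addT false W`, carries
discarded above `W`) inside Frege, by machine-found carry systems:
* `PASSOC` — `(a + b) + c` and `a + (b + c)` have the same sum bits
  (`Plain.isBlock_assocLines`, conclusion `mem_assocLines`);
* `PZADD` — `x + 0 = x` with all carries false (`Plain.isBlock_zaddLines`).

These are the base laws of the integer-multiplication layer used for the exponent laws.

## Sources

* S. A. Cook, R. A. Reckhow, *The relative efficiency of propositional proof systems*,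
  J. Symbolic Logic 44 (1979), §2.
-/

namespace Literature.Computability.MetaComplexity

open _root_.Computability Complexity Complexity.PropForm Netlist Cluster FregeSystem

namespace Plain

/-- **System `PASSOC`**: the ripple adders `(a + b) + c` and `a + (b + c)` (all carry-ins false): the sum bits agree at every position (per-position rule).
Leaves: 1 k1, 2 k2, 3 k3, 4 k4, 5 a, 6 b, 7 c; defined: 8 s1, 9 k1n, 10 t1, 11 k2n, 12 s3, 13 k3n, 14 t2, 15 k4n. Invariant: the reachable carry states (6 terms). [folklore] -/
def PASSOC : System where
  cins := [biimp (var 1) (const false), biimp (var 2) (const false), biimp (var 3) (const false), biimp (var 4) (const false)]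
  shapes := [biimp (var 8) (xor3F (var 5) (var 6) (var 1)),
    biimp (var 9) (majF (var 5) (var 6) (var 1)),
    biimp (var 10) (xor3F (var 8) (var 7) (var 2)),
    biimp (var 11) (majF (var 8) (var 7) (var 2)),
    biimp (var 12) (xor3F (var 6) (var 7) (var 3)),
    biimp (var 13) (majF (var 6) (var 7) (var 3)),
    biimp (var 14) (xor3F (var 5) (var 12) (var 4)),
    biimp (var 15) (majF (var 5) (var 12) (var 4))]
  inv := (disj (disj (conj (conj (neg (var 1)) (neg (var 2))) (conj (neg (var 3)) (neg (var 4)))) (disj (conj (conj (neg (var 1)) (var 2)) (conj (neg (var 3)) (var 4))) (conj (conj (neg (var 1)) (var 2)) (conj (var 3) (neg (var 4)))))) (disj (conj (conj (var 1) (neg (var 2))) (conj (neg (var 3)) (var 4))) (disj (conj (conj (var 1) (neg (var 2))) (conj (var 3) (neg (var 4)))) (conj (conj (var 1) (var 2)) (conj (var 3) (var 4))))))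
  next := fun k => if k = 1 then 9 else if k = 2 then 11 else if k = 3 then 13 else if k = 4 then 15 else k

/-- Per-position rule of `PASSOC`: `t1 ↔ t2`. [cite: CookReckhow1979, §2 (sound rule)] -/
def rPASSOCPos : FregeRule := PASSOC.endRule PASSOC.shapes (biimp (var 10) (var 14))

/-- **System `PZADD`**: the ripple adder `x + y` with `y` false (premise shape): every sum bit equals `x` and every carry is false (per-position rule).
Leaves: 1 k, 2 x, 3 y; defined: 4 s, 5 kn. Invariant: the reachable carry states (1 terms). [folklore] -/
def PZADD : System where
  cins := [biimp (var 1) (const false)]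
  shapes := [biimp (var 4) (xor3F (var 2) (var 3) (var 1)),
    biimp (var 5) (majF (var 2) (var 3) (var 1)),
    neg (var 3)]
  inv := (neg (var 1))
  next := fun k => if k = 1 then 5 else k

/-- Per-position rule of `PZADD`: `s ↔ x` and `¬k'`. [cite: CookReckhow1979, §2 (sound rule)] -/
def rPZADDPos : FregeRule := PZADD.endRule PZADD.shapes (conj (biimp (var 4) (var 2)) (neg (var 5)))

/-- The rules of this layer. [cite: CookReckhow1979, §2] -/
def rules : List FregeRule := [PASSOC.baseRule, PASSOC.stepRule, rPASSOCPos, PZADD.baseRule, PZADD.stepRule, rPZADDPos]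

/-- Every rule is sound. [cite: CookReckhow1979, §2 (sound rule)] -/
theorem isSound_of_mem_rules : ∀ r ∈ rules, r.IsSound := by
  intro r hr
  simp only [rules, List.mem_cons, List.not_mem_nil, or_false] at hr
  rcases hr with rfl | rfl | rfl | rfl | rfl | rfl
  · exact FregeRule.isSound_of_check (by decide +kernel)
  · exact FregeRule.isSound_of_checkD (V := 8) (ds := PASSOC.ds) (by decide +kernel)
  · exact FregeRule.isSound_of_checkD (V := 8) (ds := PASSOC.ds) (by decide +kernel)
  · exact FregeRule.isSound_of_check (by decide +kernel)
  · exact FregeRule.isSound_of_checkD (V := 4) (ds := PZADD.ds) (by decide +kernel)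
  · exact FregeRule.isSound_of_checkD (V := 4) (ds := PZADD.ds) (by decide +kernel)

/-- Leaf side conditions. [folklore] -/
theorem passocLeavesOK : PASSOC.LeavesOK := System.leavesOK_of_leavesOKB (by decide +kernel)

/-- Leaf side conditions. [folklore] -/
theorem pzaddLeavesOK : PZADD.LeavesOK := System.leavesOK_of_leavesOKB (by decide +kernel)

/-- Membership in `rules` by position. [folklore] -/
theorem mem_rules {i : ℕ} (hi : i < rules.length) : rules[i] ∈ rules := List.getElem_mem hi

variable {G : FregeSystem} {K : PropForm ℕ} {Γ : Set (PropForm ℕ)} {W : ℕ}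

/-! ### Associativity -/

/-- The four adders of the associativity law: `AB = a + b`, `T1 = AB + c`, `BC = b + c`,
`T2 = a + BC`. [folklore] -/
structure AssocData where
  /-- `a + b` -/
  AB : Adder.View
  /-- `(a + b) + c` -/
  T1 : Adder.View
  /-- `b + c` -/
  BC : Adder.View
  /-- `a + (b + c)` -/
  T2 : Adder.View

namespace AssocData

variable (d : AssocData)

/-- Leaf assignment of `PASSOC`. [folklore] -/
def act (i : ℕ) (k : ℕ) : ℕ :=
  [0, d.AB.c i, d.T1.c i, d.BC.c i, d.T2.c i, d.AB.x i, d.AB.y i, d.T1.y i, d.AB.s i, d.AB.c (i + 1), d.T1.s i, d.T1.c (i + 1),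
    d.BC.s i, d.BC.c (i + 1), d.T2.s i, d.T2.c (i + 1)].getD k 0

/-- The lines: the induction of `PASSOC` and the sum equalities. [folklore] -/
def lines (K : PropForm ℕ) (W : ℕ) : List (PropForm ℕ) :=
  PASSOC.lines K d.act W ++ (List.range W).map fun i => ctx K (eqv (d.T1.s i) (d.T2.s i))

/-- **Associativity of ripple-carry addition inside Frege** (sum bits): for available adders
`AB = a + b`, `T1 = AB + c`, `BC = b + c`, `T2 = a + BC` (carry-ins false, the operand words
wired as stated), `T1.sᵢ ↔ T2.sᵢ`. [cite: CookReckhow1979, §2] -/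
theorem isBlock_lines (hGP : ∀ r ∈ rules, r ∈ G.rules) (hAB : d.AB.Avail K Γ false W) (hT1 : d.T1.Avail K Γ false W)
    (hBC : d.BC.Avail K Γ false W) (hT2 : d.T2.Avail K Γ false W) (h1x : ∀ i < W, d.T1.x i = d.AB.s i)
    (hbx : ∀ i < W, d.BC.x i = d.AB.y i) (hby : ∀ i < W, d.BC.y i = d.T1.y i) (h2x : ∀ i < W, d.T2.x i = d.AB.x i)
    (h2y : ∀ i < W, d.T2.y i = d.BC.s i) : G.IsBlock Γ (d.lines K W) := by
  have hsh : ∀ {T' : Set (PropForm ℕ)}, Γ ⊆ T' → ∀ i < W, ∀ φ ∈ PASSOC.shapes, ctx K (inst (d.act i) φ) ∈ T' := by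
    intro T' hT i hi φ hφ
    simp only [PASSOC, List.mem_cons, List.not_mem_nil, or_false] at hφ
    rcases hφ with rfl | rfl | rfl | rfl | rfl | rfl | rfl | rfl
    · exact hT (hAB.2 i hi).1
    · exact hT (hAB.2 i hi).2
    · have := (hT1.2 i hi).1; rw [Adder.View.sumDef, h1x i hi] at this; exact hT this
    · have := (hT1.2 i hi).2; rw [Adder.View.carryDef, h1x i hi] at this; exact hT this
    · have := (hBC.2 i hi).1; rw [Adder.View.sumDef, hbx i hi, hby i hi] at this; exact hT this
    · have := (hBC.2 i hi).2; rw [Adder.View.carryDef, hbx i hi, hby i hi] at this; exact hT this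
    · have := (hT2.2 i hi).1; rw [Adder.View.sumDef, h2x i hi, h2y i hi] at this; exact hT this
    · have := (hT2.2 i hi).2; rw [Adder.View.carryDef, h2x i hi, h2y i hi] at this; exact hT this
  refine (System.isBlock_lines passocLeavesOK (hGP _ (mem_rules (i := 0) (by decide))) (hGP _ (mem_rules (i := 1) (by decide))) K d.act W
    (ModAddU.hcoh_of (p := fun k => decide (1 ≤ k ∧ k ≤ 4)) (by decide +kernel) fun i _ k hk => by
      simp only [decide_eq_true_eq] at hk
      obtain ⟨hk₁, hk₂⟩ := hk
      interval_cases k <;> rfl)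
    (fun φ hφ => by
      simp only [PASSOC, List.mem_cons, List.not_mem_nil, or_false] at hφ
      rcases hφ with rfl | rfl | rfl | rfl
      exacts [hAB.1, hT1.1, hBC.1, hT2.1])
    (hsh le_rfl)).append (Scaffold.isBlock_of_forall fun θ hθ => ?_)
  obtain ⟨i, hi, rfl⟩ := List.mem_map.1 hθ
  rw [List.mem_range] at hi
  exact Or.inr (System.isInferredFrom_end passocLeavesOK.inv_ne_zero (hGP _ (mem_rules (i := 2) (by decide))) passocLeavesOK.2.1
    (ModAddU.ne_zero_of_allVarsB (by decide +kernel)) K d.act i (Or.inr (System.mem_lines PASSOC K _ hi.le)) (hsh Set.subset_union_left i hi))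

/-- The conclusions: `T1.sᵢ ↔ T2.sᵢ`. [folklore] -/
theorem mem_lines {i : ℕ} (hi : i < W) : ctx K (eqv (d.T1.s i) (d.T2.s i)) ∈ d.lines K W :=
  List.mem_append_right _ (List.mem_map.2 ⟨i, List.mem_range.2 hi, rfl⟩)

/-- Size of the associativity law. [folklore] -/
theorem proofSize_lines (K : PropForm ℕ) (W : ℕ) : proofSize (d.lines K W) ≤ (2 * W + 1) * (K.size + 130) := by
  have hI : PASSOC.inv.size = 59 := by decide +kernel
  refine ((ModAddU.bounded_sysLines (B := K.size + 130) _ _ _ _ (by omega)).append (ModAddU.Bounded.map fun i _ => ?_)).proofSize_le.trans ?_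
  · rw [ModAddU.size_ctx]; simp [eqv, size, FregeSystem.size_biimp]
  · simp [System.lines]; nlinarith

end AssocData

/-! ### Adding zero -/

/-- Leaf assignment of `PZADD` for an adder view `S = x + y`. [folklore] -/
def zaddAct (S : Adder.View) (i : ℕ) (k : ℕ) : ℕ := [0, S.c i, S.x i, S.y i, S.s i, S.c (i + 1)].getD k 0

/-- The lines: the induction of `PZADD` and its per-position conclusions. [folklore] -/
def zaddLines (S : Adder.View) (K : PropForm ℕ) (W : ℕ) : List (PropForm ℕ) :=
  PZADD.lines K (zaddAct S) W ++ (List.range W).map fun i => ctx K (inst (zaddAct S i) (conj (biimp (var 4) (var 2)) (neg (var 5))))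

/-- **Adding zero**: for an available adder `x + y` (carry-in false) with `y` bitwise false,
`sᵢ ↔ xᵢ` and every carry is false. [cite: CookReckhow1979, §2] -/
theorem isBlock_zaddLines (hGP : ∀ r ∈ rules, r ∈ G.rules) {S : Adder.View} (hS : S.Avail K Γ false W)
    (hy : ∀ i < W, ctx K (neg (var (S.y i))) ∈ Γ) : G.IsBlock Γ (zaddLines S K W) := by
  have hsh : ∀ {T' : Set (PropForm ℕ)}, Γ ⊆ T' → ∀ i < W, ∀ φ ∈ PZADD.shapes, ctx K (inst (zaddAct S i) φ) ∈ T' := by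
    intro T' hT i hi φ hφ
    simp only [PZADD, List.mem_cons, List.not_mem_nil, or_false] at hφ
    rcases hφ with rfl | rfl | rfl
    exacts [hT (hS.2 i hi).1, hT (hS.2 i hi).2, hT (hy i hi)]
  refine (System.isBlock_lines pzaddLeavesOK (hGP _ (mem_rules (i := 3) (by decide))) (hGP _ (mem_rules (i := 4) (by decide))) K (zaddAct S) W
    (ModAddU.hcoh_of (p := fun k => decide (k = 1)) (by decide +kernel) fun i _ k hk => by
      simp only [decide_eq_true_eq] at hk; subst hk; rfl)
    (fun φ hφ => by
      simp only [PZADD, List.mem_cons, List.not_mem_nil, or_false] at hφ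
      subst hφ; exact hS.1)
    (hsh le_rfl)).append (Scaffold.isBlock_of_forall fun θ hθ => ?_)
  obtain ⟨i, hi, rfl⟩ := List.mem_map.1 hθ
  rw [List.mem_range] at hi
  exact Or.inr (System.isInferredFrom_end pzaddLeavesOK.inv_ne_zero (hGP _ (mem_rules (i := 5) (by decide))) pzaddLeavesOK.2.1
    (ModAddU.ne_zero_of_allVarsB (by decide +kernel)) K (zaddAct S) i (Or.inr (System.mem_lines PZADD K _ hi.le)) (hsh Set.subset_union_left i hi))

/-- The conclusions of adding zero: `sᵢ ↔ xᵢ` and `¬c_{i+1}`. [folklore] -/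
theorem mem_zaddLines {S : Adder.View} {i : ℕ} (hi : i < W) :
    ctx K (conj (eqv (S.s i) (S.x i)) (neg (var (S.c (i + 1))))) ∈ zaddLines S K W :=
  List.mem_append_right _ (List.mem_map.2 ⟨i, List.mem_range.2 hi, rfl⟩)

/-- Size of adding zero. [folklore] -/
theorem proofSize_zaddLines (S : Adder.View) (K : PropForm ℕ) (W : ℕ) : proofSize (zaddLines S K W) ≤ (2 * W + 1) * (K.size + 20) := by
  have hI : PZADD.inv.size = 2 := by decide +kernel
  refine ((ModAddU.bounded_sysLines (B := K.size + 20) _ _ _ _ (by omega)).append (ModAddU.Bounded.map fun i _ => ?_)).proofSize_le.trans ?_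
  · rw [ModAddU.size_ctx, ModAddU.size_inst]; simp [size, FregeSystem.size_biimp]
  · simp [System.lines]; nlinarith

/-- `[(s ↔ x) ∧ ¬c] ⊢ s ↔ x` and `⊢ ¬c`: splitting the conjunction. [cite: CookReckhow1979, §2 (sound rule)] -/
def rConjL : FregeRule := ⟨[ctx (var 0) (conj (var 1) (var 2))], ctx (var 0) (var 1)⟩
/-- `[(s ↔ x) ∧ ¬c] ⊢ ¬c`. [cite: CookReckhow1979, §2 (sound rule)] -/
def rConjR : FregeRule := ⟨[ctx (var 0) (conj (var 1) (var 2))], ctx (var 0) (var 2)⟩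

/-- The splitting rules. [cite: CookReckhow1979, §2] -/
def splitRules : List FregeRule := [rConjL, rConjR]

/-- The splitting rules are sound. [cite: CookReckhow1979, §2 (sound rule)] -/
theorem isSound_of_mem_splitRules : ∀ r ∈ splitRules, r.IsSound := by
  intro r hr
  simp only [splitRules, List.mem_cons, List.not_mem_nil, or_false] at hr
  rcases hr with rfl | rfl <;> exact FregeRule.isSound_of_check (by decide +kernel)

/-- The split conclusions of adding zero. [folklore] -/
def zaddSplit (S : Adder.View) (K : PropForm ℕ) (W : ℕ) : List (PropForm ℕ) :=
  (List.range W).map (fun i => ctx K (eqv (S.s i) (S.x i))) ++ (List.range W).map fun i => ctx K (neg (var (S.c (i + 1))))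

/-- **Adding zero, split form**: `sᵢ ↔ xᵢ` and `¬c_{i+1}` as separate lines. [cite: CookReckhow1979, §2] -/
theorem isBlock_zaddSplit (hGP : ∀ r ∈ rules, r ∈ G.rules) (hGX : ∀ r ∈ splitRules, r ∈ G.rules) {S : Adder.View} (hS : S.Avail K Γ false W)
    (hy : ∀ i < W, ctx K (neg (var (S.y i))) ∈ Γ) : G.IsBlock Γ (zaddLines S K W ++ zaddSplit S K W) := by
  refine (isBlock_zaddLines hGP hS hy).append (Scaffold.isBlock_of_forall fun θ hθ => ?_)
  rcases List.mem_append.1 hθ with hθ | hθ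
  · obtain ⟨i, hi, rfl⟩ := List.mem_map.1 hθ
    rw [List.mem_range] at hi
    exact Or.inr (FregeSystem.IsInferredFrom.of_rule (hGX rConjL (by simp [splitRules])) (FregeSystem.sub [K, eqv (S.s i) (S.x i), neg (var (S.c (i + 1)))]) rfl
      (FregeSystem.prems_cons (Or.inr (mem_zaddLines hi)) FregeSystem.prems_nil))
  · obtain ⟨i, hi, rfl⟩ := List.mem_map.1 hθ
    rw [List.mem_range] at hi
    exact Or.inr (FregeSystem.IsInferredFrom.of_rule (hGX rConjR (by simp [splitRules])) (FregeSystem.sub [K, eqv (S.s i) (S.x i), neg (var (S.c (i + 1)))]) rfl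
      (FregeSystem.prems_cons (Or.inr (mem_zaddLines hi)) FregeSystem.prems_nil))

/-- The split conclusions. [folklore] -/
theorem mem_zaddSplit {S : Adder.View} {i : ℕ} (hi : i < W) :
    ctx K (eqv (S.s i) (S.x i)) ∈ zaddLines S K W ++ zaddSplit S K W ∧ ctx K (neg (var (S.c (i + 1)))) ∈ zaddLines S K W ++ zaddSplit S K W :=
  ⟨List.mem_append_right _ (List.mem_append_left _ (List.mem_map.2 ⟨i, List.mem_range.2 hi, rfl⟩)),
    List.mem_append_right _ (List.mem_append_right _ (List.mem_map.2 ⟨i, List.mem_range.2 hi, rfl⟩))⟩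

/-- Size of the split form. [folklore] -/
theorem proofSize_zaddSplit (S : Adder.View) (K : PropForm ℕ) (W : ℕ) : proofSize (zaddLines S K W ++ zaddSplit S K W) ≤ (4 * W + 1) * (K.size + 20) := by
  rw [proofSize_append]
  have h1 := proofSize_zaddLines S K W
  have h2 : proofSize (zaddSplit S K W) ≤ 2 * W * (K.size + 10) := by
    rw [zaddSplit, proofSize_append]
    have a : proofSize ((List.range W).map fun i => ctx K (eqv (S.s i) (S.x i))) ≤ W * (K.size + 10) :=
      proofSize_map_range_le fun i _ => by simp [ctx, eqv, size, FregeSystem.size_biimp]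
    have b : proofSize ((List.range W).map fun i => ctx K (neg (var (S.c (i + 1))))) ≤ W * (K.size + 10) :=
      proofSize_map_range_le fun i _ => by simp [ctx, size]
    have e : W * (K.size + 10) + W * (K.size + 10) = 2 * W * (K.size + 10) := by ring
    omega
  nlinarith

end Plain

end Literature.Computability.MetaComplexity
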